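import Literature.MathematicalPhysics.QuantumFieldTheory.Balaban1983to89.B9Eq3130RightNeumannTransfer

/-!
# `Balaban1983to89.B9Eq3130RightNeumannTransferDifference` — T. Bałaban, *Propagators for lattice gauge theories in a background field*, Commun. Math. Phys. **99** (1985) 389–434
# [Balaban1985BackgroundPropagators] (3.130)–(3.131) pp. 421–422 *«G = G₀(I − Δ′_πG₀)⁻¹ = Σ_{n=0}^{∞} G₀(Δ′_πG₀)ⁿ … This inequality and Theorem 3.3 for G₀ imply a convergence of the
# series (3.130)»*, Thm 3.13 p. 426, Thm 3.1 (3.42)–(3.47) pp. 397–398: **THE RIGHT-GROUPED TRANSFER, DIFFERENCE FORM — every row `X∘G₀` of the chain's `G₀` gives the row of the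
# DIFFERENCE `X∘G̃ − X∘G₀ = (X∘G₀)∘K♭∘𝔅` with the small factor `q` (one stencil constant `ε` or `ε′` in every summand)** — the companion of ne9-leaf-03∕owner's
# `B9Eq3130RightNeumannTransfer.letter_postcomp_transfer` ∕ `letter_right_transfer_torus` (which bound `X∘G̃` by `B_X + M_𝔅qS′B_XS′`); here only the second summand, for the
# slot differences `G̃_k − G₁,k`, `D*∘(G̃_k − G₁,k)`, `D_μ∘(G̃_k − G₁,k)` that the π-side of ROUTE (J′) consumes (the GRADIENT member in particular — no Hessian row is needed on
# this road, unlike the left-grouped `B9Eq3130TransferPairDifference`)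

statement-level skeleton of published theorems with citation tags; proofs where landed; nothing here is a claim about the Yang–Mills mass gap

CITATION HEADER (lean-in-tree rule).  Audit cell `pub-balaban`, sub-cell `t4`, BINDER row NE9; filed by NE9 crux-team LEAF PROVER 01 (`b2b-balaban-t4-ne9-formalise-leaf-01`, gen 101;
ROUTE (J′), π-side; bears_on: R4/N22).  Composition BY NAME: `B9Eq3130RightNeumannTransfer.{letter_Kflat, letter_dressing}` (the letters of `K♭` and of the dressing operator `𝔅`),
ne9-leaf-05's `B9Eq326G1SupRowOfLetters.letter_comp`, `B4Sect5Torus.torusSum_le`.  Source READ first-hand in the held text layer `paper:balaban1985-cmp99-background-propagators`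
(journal page = PDF page + 388) pp. 421–422, 426.  NOTHING of print's proofs is reproduced: [folklore] letter algebra (the statement text of `letter_right_transfer_torus` VERBATIM with the
conclusion's leading `B_X +` removed and `X∘G̃` replaced by `X∘G̃ − X∘G₀`).

WHAT IS PROVED (sorry-free; proof lane — 0 `def`; [folklore]).
* §1 **`letter_postcomp_transfer_sub`** (abstract block lattice) — `hB : 𝔅f = f + K♭(𝔅f)`, `hG : G̃f = G₀(𝔅f)`, (L)(X∘G₀; B_X, κ′), (L)(K♭; q, κ′), (L)(𝔅; M_𝔅, κ″),
  `Σ_u e^{−(κ′−κ″)δ(w,u)} ≤ S′` ⟹ **(L)(X∘G̃ − X∘G₀; M_𝔅·q·S′·B_X·S′, κ″)** — `X(G̃f) − X(G₀f) = (X∘G₀)(K♭(𝔅f))`, two `letter_comp`.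
* §2 **`letter_right_transfer_torus_sub`** (the coarse torus `T_m`) — the hypotheses of `letter_right_transfer_torus` VERBATIM ⟹
  **(L)(X∘G̃ − X∘G₀; (1∕(1 − qK′K′))·q·K′·B_X·K′, κ″)**, `q := εB₁B₂K² + ε′B₄(B₀ + B₁B₃K)K²`, `K = K_d(κ−κ′)`, `K′ = K_d(κ′−κ″)`.
HONEST SCOPE.  Letter algebra; the identities and all letters are HYPOTHESES (the instantiator's: `B9Eq3130GtildeTransferTowerDifference`); constants crude; nothing of [B9] (3.130)–(3.133),
Thm 3.3∕3.13 asserted, valued or discharged; «NE9 ⇐ the named binders»; NE9 NOT PRINTED ∕ NOT PROVED; row WALLED ON A MODEL (O-NE9-1; #5 UNRULED); spine PROVED 0∕9; rung (B)+1 on a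
finite T⁴ — NOT infinite volume, NOT mass gap, NOT BetaPertH, NOT Clay.  HONEST DEPENDENCY: continuum YM on T⁴ ⇐ BetaPertH ∧ nine spine estimates (0/9 proved); BetaPertH ⇐ (D1) ∧ (D4) ∧
CAP+tail; G-an2-4 gates asym, D1 and NE2/3/4.  NEW file importing `B9Eq3130RightNeumannTransfer` only; nothing modified.  Net new unproved facts: 0.
-/

noncomputable section

set_option autoImplicit false

open scoped BigOperators

namespace Literature.MathematicalPhysics.QuantumFieldTheory.Balaban1983to89.B9Eq3130RightNeumannTransferDifference

open B9Eq311L2Pairing (WL2)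
open B4Sect5Torus (TSite tdist tdist_triangle tdist_nonneg tdist_self torusSum_le)
open B4Sect5Proof (latticeConst latticeConst_nonneg)
open B9Eq326G1SupRowOfLetters (letter_comp)
open B9Eq3130RightNeumannTransfer (letter_Kflat letter_dressing)

/-! ## §1 The difference `X∘G̃ − X∘G₀` on an abstract block lattice -/

section Abstract

variable {𝕜 : Type*} [RCLike 𝕜] {Y : Type*} [Fintype Y] (δ : Y → Y → ℝ)
  {XB : Type*} [Fintype XB] [Nonempty XB] {wB : XB → ℝ} [Fact (∀ x, 0 < wB x)]
  {VB : Type*} [NormedAddCommGroup VB] [InnerProductSpace 𝕜 VB]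
  (πB : XB → Y) (G₀ : WL2 𝕜 wB VB →L[𝕜] WL2 𝕜 wB VB)

/-- **THE DIFFERENCE `X∘G̃ − X∘G₀` TRANSFERS BY TWO COMPOSITIONS** — with `G̃ = G₀∘𝔅` (`hG`) and `𝔅 = 1 + K♭∘𝔅` (`hB`): `X(G̃f) − X(G₀f) = (X∘G₀)(K♭(𝔅f))`, so the letters
(L)(𝔅; M_𝔅, κ″), (L)(K♭; q, κ′), (L)(X∘G₀; B_X, κ′) and the row constant `S′` of the gap `κ′ − κ″` give (L)(X∘G̃ − X∘G₀; M_𝔅·q·S′·B_X·S′, κ″) — the `q`-carrying summand of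
`letter_postcomp_transfer`. [folklore] [cite: Balaban1985BackgroundPropagators, (3.130)–(3.131) pp.421–422, Thm 3.13 p.426, Thm 3.1 (3.42) p.397]
[cite: Balaban1984PropagatorsII, Lemma 2.1 (2.61) p.234] -/
theorem letter_postcomp_transfer_sub {X₂ : Type*} [Fintype X₂] {w₂ : X₂ → ℝ} [Fact (∀ x, 0 < w₂ x)] {V₂ : Type*} [NormedAddCommGroup V₂]
    [InnerProductSpace 𝕜 V₂] (π₂ : X₂ → Y) (X : WL2 𝕜 wB VB →L[𝕜] WL2 𝕜 w₂ V₂)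
    (hδ0 : ∀ u v, 0 ≤ δ u v) (hδt : ∀ u y v, δ u v ≤ δ u y + δ y v)
    (Kf Bb Gt : WL2 𝕜 wB VB →L[𝕜] WL2 𝕜 wB VB) (hB : ∀ f, Bb f = f + Kf (Bb f)) (hG : ∀ f, Gt f = G₀ (Bb f))
    {BX q MB κ' κ'' S' : ℝ} (hBX : 0 ≤ BX) (hq0 : 0 ≤ q) (hMB : 0 ≤ MB) (hκ'' : 0 ≤ κ'') (_hκ' : κ'' < κ')
    (hXG₀ : ∀ (v : Y) (f : WL2 𝕜 wB VB) (F : ℝ), (∀ x, πB x ≠ v → WL2.equiv 𝕜 wB VB f x = 0) → (∀ x, ‖WL2.equiv 𝕜 wB VB f x‖ ≤ F) →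
      ∀ x, ‖WL2.equiv 𝕜 w₂ V₂ ((X ∘L G₀) f) x‖ ≤ BX * Real.exp (-(κ' * δ (π₂ x) v)) * F)
    (hKf : ∀ (v : Y) (f : WL2 𝕜 wB VB) (F : ℝ), (∀ x, πB x ≠ v → WL2.equiv 𝕜 wB VB f x = 0) → (∀ x, ‖WL2.equiv 𝕜 wB VB f x‖ ≤ F) →
      ∀ x, ‖WL2.equiv 𝕜 wB VB (Kf f) x‖ ≤ q * Real.exp (-(κ' * δ (πB x) v)) * F)
    (hBb : ∀ (v : Y) (f : WL2 𝕜 wB VB) (F : ℝ), (∀ x, πB x ≠ v → WL2.equiv 𝕜 wB VB f x = 0) → (∀ x, ‖WL2.equiv 𝕜 wB VB f x‖ ≤ F) →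
      ∀ x, ‖WL2.equiv 𝕜 wB VB (Bb f) x‖ ≤ MB * Real.exp (-(κ'' * δ (πB x) v)) * F)
    (hS' : ∀ w', ∑ u, Real.exp (-((κ' - κ'') * δ w' u)) ≤ S')
    (v : Y) (f : WL2 𝕜 wB VB) (F : ℝ) (hfv : ∀ x, πB x ≠ v → WL2.equiv 𝕜 wB VB f x = 0) (hfF : ∀ x, ‖WL2.equiv 𝕜 wB VB f x‖ ≤ F) (x : X₂) :
    ‖WL2.equiv 𝕜 w₂ V₂ ((X ∘L Gt - X ∘L G₀) f) x‖ ≤ (MB * q * S' * BX * S') * Real.exp (-(κ'' * δ (π₂ x) v)) * F := by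
  have hPT : (X ∘L Gt - X ∘L G₀) f = ((X ∘L G₀) ∘L (Kf ∘L Bb)) f := by
    simp only [sub_apply, ContinuousLinearMap.coe_comp, Function.comp_apply]
    rw [hG f]
    conv_lhs => rw [hB f]
    rw [map_add, map_add]
    abel
  have hS'0 : 0 ≤ S' := (Finset.sum_nonneg fun u _ => Real.exp_nonneg _).trans (hS' v)
  have c1 := letter_comp δ πB πB πB Bb Kf hδ0 hδt hMB hq0 hκ'' le_rfl hBb hKf hS'
  have c2 := letter_comp δ πB πB π₂ (Kf ∘L Bb) (X ∘L G₀) hδ0 hδt (mul_nonneg (mul_nonneg hMB hq0) hS'0) hBX hκ'' le_rfl c1 hXG₀ hS' v f F hfv hfF x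
  rw [hPT]
  exact c2.trans (le_of_eq (by ring))

end Abstract

/-! ## §2 Over the coarse torus `T_m`: the difference form of `letter_right_transfer_torus` -/

section Lattice

variable {𝕜 : Type*} [RCLike 𝕜] {d : ℕ} {m : Fin d → ℕ}
  {XB : Type*} [Fintype XB] [Nonempty XB] {wB : XB → ℝ} [Fact (∀ x, 0 < wB x)]
  {XS : Type*} [Fintype XS] {wS : XS → ℝ} [Fact (∀ x, 0 < wS x)]
  {VB : Type*} [NormedAddCommGroup VB] [InnerProductSpace 𝕜 VB] {VS : Type*} [NormedAddCommGroup VS] [InnerProductSpace 𝕜 VS]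
  (πB : XB → TSite d m) (πS : XS → TSite d m)
  (G₀ : WL2 𝕜 wB VB →L[𝕜] WL2 𝕜 wB VB) (M D : WL2 𝕜 wS VS →L[𝕜] WL2 𝕜 wB VB) (Mt Ds : WL2 𝕜 wB VB →L[𝕜] WL2 𝕜 wS VS)
  (Gp R : WL2 𝕜 wS VS →L[𝕜] WL2 𝕜 wS VS)

/-- **THE RIGHT-GROUPED (3.130) TRANSFER OVER THE COARSE TORUS, DIFFERENCE FORM** — the hypotheses of `B9Eq3130RightNeumannTransfer.letter_right_transfer_torus` VERBATIM
(`δ = d_m`, `1 ≤ m_i`, the displayed word `hKf`, the identities `hB`, `hG`, the SEVEN letters at rate `κ`, ANY post-composition `X` with (L)(X∘G₀; B_X, κ′), `qK′K′ < 1`) ⟹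
**(L)(X∘G̃ − X∘G₀; (1∕(1 − qK′K′))·q·K′·B_X·K′, κ″)** — at `X = 1`, `X = D*_U`, `X =` the slice derivative: the value, divergence and gradient rows of `G̃ − G₀` with the
stencil smallness `q`. [folklore] [cite: Balaban1985BackgroundPropagators, (3.130) p.421, Thm 3.13 p.426, Thm 3.1 (3.42)–(3.47) pp.397–398]
[cite: Balaban1984PropagatorsII, Lemma 2.1 (2.61) p.234] -/
theorem letter_right_transfer_torus_sub {X₂ : Type*} [Fintype X₂] {w₂ : X₂ → ℝ} [Fact (∀ x, 0 < w₂ x)] {V₂ : Type*} [NormedAddCommGroup V₂]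
    [InnerProductSpace 𝕜 V₂] (π₂ : X₂ → TSite d m) (X : WL2 𝕜 wB VB →L[𝕜] WL2 𝕜 w₂ V₂) (hm : ∀ i, 1 ≤ m i)
    (Kf Bb Gt : WL2 𝕜 wB VB →L[𝕜] WL2 𝕜 wB VB)
    (hKf : Kf = M ∘L (Gp ∘L R) ∘L (Ds ∘L G₀) + (D ∘L R ∘L Gp) ∘L Mt ∘L (G₀ - (D ∘L Gp ∘L R) ∘L (Ds ∘L G₀)))
    (hB : ∀ f, Bb f = f + Kf (Bb f)) (hG : ∀ f, Gt f = G₀ (Bb f))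
    {B₀ B₁ B₂ B₃ B₄ ε ε' BX κ κ' κ'' : ℝ} (hB₀ : 0 ≤ B₀) (hB₁ : 0 ≤ B₁) (hB₂ : 0 ≤ B₂) (hB₃ : 0 ≤ B₃) (hB₄ : 0 ≤ B₄) (hε : 0 ≤ ε)
    (hε' : 0 ≤ ε') (hBX : 0 ≤ BX) (hκ'' : 0 ≤ κ'') (hκ' : κ'' < κ') (hκ : κ' < κ)
    (hG₀ : ∀ (v : TSite d m) (f : WL2 𝕜 wB VB) (F : ℝ), (∀ x, πB x ≠ v → WL2.equiv 𝕜 wB VB f x = 0) → (∀ x, ‖WL2.equiv 𝕜 wB VB f x‖ ≤ F) →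
      ∀ x, ‖WL2.equiv 𝕜 wB VB (G₀ f) x‖ ≤ B₀ * Real.exp (-(κ * tdist m (πB x) v)) * F)
    (hDsG₀ : ∀ (v : TSite d m) (f : WL2 𝕜 wB VB) (F : ℝ), (∀ x, πB x ≠ v → WL2.equiv 𝕜 wB VB f x = 0) → (∀ x, ‖WL2.equiv 𝕜 wB VB f x‖ ≤ F) →
      ∀ x, ‖WL2.equiv 𝕜 wS VS ((Ds ∘L G₀) f) x‖ ≤ B₁ * Real.exp (-(κ * tdist m (πS x) v)) * F)
    (hGpR : ∀ (v : TSite d m) (f : WL2 𝕜 wS VS) (F : ℝ), (∀ x, πS x ≠ v → WL2.equiv 𝕜 wS VS f x = 0) → (∀ x, ‖WL2.equiv 𝕜 wS VS f x‖ ≤ F) →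
      ∀ x, ‖WL2.equiv 𝕜 wS VS ((Gp ∘L R) f) x‖ ≤ B₂ * Real.exp (-(κ * tdist m (πS x) v)) * F)
    (hDGpR : ∀ (v : TSite d m) (f : WL2 𝕜 wS VS) (F : ℝ), (∀ x, πS x ≠ v → WL2.equiv 𝕜 wS VS f x = 0) → (∀ x, ‖WL2.equiv 𝕜 wS VS f x‖ ≤ F) →
      ∀ x, ‖WL2.equiv 𝕜 wB VB ((D ∘L Gp ∘L R) f) x‖ ≤ B₃ * Real.exp (-(κ * tdist m (πB x) v)) * F)
    (hDRGp : ∀ (v : TSite d m) (f : WL2 𝕜 wS VS) (F : ℝ), (∀ x, πS x ≠ v → WL2.equiv 𝕜 wS VS f x = 0) → (∀ x, ‖WL2.equiv 𝕜 wS VS f x‖ ≤ F) →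
      ∀ x, ‖WL2.equiv 𝕜 wB VB ((D ∘L R ∘L Gp) f) x‖ ≤ B₄ * Real.exp (-(κ * tdist m (πB x) v)) * F)
    (hM : ∀ (v : TSite d m) (f : WL2 𝕜 wS VS) (F : ℝ), (∀ x, πS x ≠ v → WL2.equiv 𝕜 wS VS f x = 0) → (∀ x, ‖WL2.equiv 𝕜 wS VS f x‖ ≤ F) →
      ∀ x, ‖WL2.equiv 𝕜 wB VB (M f) x‖ ≤ ε * Real.exp (-(κ * tdist m (πB x) v)) * F)
    (hMt : ∀ (v : TSite d m) (f : WL2 𝕜 wB VB) (F : ℝ), (∀ x, πB x ≠ v → WL2.equiv 𝕜 wB VB f x = 0) → (∀ x, ‖WL2.equiv 𝕜 wB VB f x‖ ≤ F) →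
      ∀ x, ‖WL2.equiv 𝕜 wS VS (Mt f) x‖ ≤ ε' * Real.exp (-(κ * tdist m (πS x) v)) * F)
    (hXG₀ : ∀ (v : TSite d m) (f : WL2 𝕜 wB VB) (F : ℝ), (∀ x, πB x ≠ v → WL2.equiv 𝕜 wB VB f x = 0) → (∀ x, ‖WL2.equiv 𝕜 wB VB f x‖ ≤ F) →
      ∀ x, ‖WL2.equiv 𝕜 w₂ V₂ ((X ∘L G₀) f) x‖ ≤ BX * Real.exp (-(κ' * tdist m (π₂ x) v)) * F)
    (hq : (ε * B₁ * B₂ * latticeConst d (κ - κ') ^ 2 + ε' * B₄ * (B₀ + B₁ * B₃ * latticeConst d (κ - κ')) * latticeConst d (κ - κ') ^ 2) *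
      latticeConst d (κ' - κ'') * 1 * latticeConst d (κ' - κ'') < 1)
    (v : TSite d m) (f : WL2 𝕜 wB VB) (F : ℝ) (hfv : ∀ x, πB x ≠ v → WL2.equiv 𝕜 wB VB f x = 0) (hfF : ∀ x, ‖WL2.equiv 𝕜 wB VB f x‖ ≤ F) (x : X₂) :
    ‖WL2.equiv 𝕜 w₂ V₂ ((X ∘L Gt - X ∘L G₀) f) x‖ ≤
      (1 / (1 - (ε * B₁ * B₂ * latticeConst d (κ - κ') ^ 2 + ε' * B₄ * (B₀ + B₁ * B₃ * latticeConst d (κ - κ')) * latticeConst d (κ - κ') ^ 2) *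
          latticeConst d (κ' - κ'') * 1 * latticeConst d (κ' - κ'')) *
        (ε * B₁ * B₂ * latticeConst d (κ - κ') ^ 2 + ε' * B₄ * (B₀ + B₁ * B₃ * latticeConst d (κ - κ')) * latticeConst d (κ - κ') ^ 2) *
        latticeConst d (κ' - κ'') * BX * latticeConst d (κ' - κ'')) * Real.exp (-(κ'' * tdist m (π₂ x) v)) * F := by
  set K := latticeConst d (κ - κ') with hK
  set K' := latticeConst d (κ' - κ'') with hK'
  set q := ε * B₁ * B₂ * K ^ 2 + ε' * B₄ * (B₀ + B₁ * B₃ * K) * K ^ 2 with hqdef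
  have hKnn : 0 ≤ K := latticeConst_nonneg d (sub_nonneg.2 hκ.le)
  have hK'nn : 0 ≤ K' := latticeConst_nonneg d (sub_nonneg.2 hκ'.le)
  have hq0 : 0 ≤ q := by positivity
  have hδ0 := tdist_nonneg m
  have hδt : ∀ u y w', tdist m u w' ≤ tdist m u y + tdist m y w' := fun u y w' => tdist_triangle hm u y w'
  have hS : ∀ w', ∑ u, Real.exp (-((κ - κ') * tdist m w' u)) ≤ K := fun w' => torusSum_le d hm (sub_pos.2 hκ) w'
  have hS' : ∀ w', ∑ u, Real.exp (-((κ' - κ'') * tdist m w' u)) ≤ K' := fun w' => torusSum_le d hm (sub_pos.2 hκ') w'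
  -- (L)(K♭; q, κ′)
  have hKfL := letter_Kflat (tdist m) πB πS G₀ M D Mt Ds Gp R hδ0 hδt Kf hKf hB₀ hB₁ hB₂ hB₃ hB₄ hε hε' (hκ''.trans hκ'.le) hκ.le hG₀ hDsG₀ hGpR hDGpR hDRGp
    hM hMt hS
  -- (L)(𝔅; 1∕(1 − qK′K′), κ″)
  have hMB : 0 ≤ 1 / (1 - q * K' * 1 * K') := by
    have : q * K' * 1 * K' < 1 := hq
    exact div_nonneg zero_le_one (by linarith)
  have hBbL := letter_dressing (tdist m) πB hδ0 hδt (fun v => tdist_self m v) Kf Bb hB hq0 hκ'' hκ' hKfL hS' hq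
  exact letter_postcomp_transfer_sub (tdist m) πB G₀ π₂ X hδ0 hδt Kf Bb Gt hB hG hBX hq0 hMB hκ'' hκ' hXG₀ hKfL hBbL hS' v f F hfv hfF x

end Lattice

end Literature.MathematicalPhysics.QuantumFieldTheory.Balaban1983to89.B9Eq3130RightNeumannTransferDifference

end
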